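import Literature.IUT.HodgeArakelov.CohomologyAutFunctorialityComp

/-!
# Functoriality LAWS of the automorphism-pair action on `H¹` and on `lim_K H¹(H|_K, A)`: identity and composition

Follow-up (proof-only) to abc-iut-L6-t1's `CohomologyAutFunctoriality.lean` (the action `autMap` / `h1LimAut` of a
compatible automorphism PAIR `(α, β)`) and `CohomologyAutEquiv.lean` (`h1LimAutEquiv`, inverse pair), and to
abc-iut-w5-d072's `CohomologyAutFunctorialityComp.lean` (the `H¹`-level laws `autMap_refl` / `autMap_trans`, USED here).  For the
functoriality of the group-theoretic theta-monoid algorithm in isomorphisms of `Π` ([IUTchII] Prop 3.4 (i) p. 91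
"the left-hand square in each diagram arises from the functoriality of the algorithms involved"; junction J10 of
`plan/L6/SUBDAG-IUTchII-Prop-31-33-34.md`, consumer `TemperedThetaMonoids.ThetaEnvData.AutIsoAction` of
`ThetaMonoidsMultiradialTransport.lean`) one needs that the assignment `(α, β) ↦ h1LimAut (α, β)` is a
HOMOMORPHISM: the identity pair acts as the identity and a composite pair acts as the composite.  This file proves
exactly that AT THE LIMIT (the `H¹` level being abc-iut-w5-d072's), by the bookkeeping pattern of `h1LimAut_symm_h1LimAut`
(compare indices `α₂(α₁ K) = (α₁ ≫ α₂)(K)` through `h1Of_fmod` along an equality of subgroups).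
Standard mathematics (transport of structure on group cohomology, [cite: NeukirchSchmidtWingberg2008, I §5]);
nothing of [IUTchII] is asserted; no side taken on [IUTchIII] Cor 3.12.  abc-iut cell, seat abc-iut-w5-d169 (gen 2).
-/

namespace Literature.IUT.HodgeArakelov

open Literature.AnabelianGeometry.EtaleTheta CohomologySystemOfContH1

universe u

noncomputable section

namespace ContH1Aut

variable {G : Type u} {G' : Type u} [Group G] [TopologicalSpace G]
  [Group G'] [TopologicalSpace G'] [IsTopologicalGroup G']
  (φ : G →* G') (A : Subgroup G') [A.Normal] [IsMulCommutative A]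

omit [IsTopologicalGroup G'] [A.Normal] [IsMulCommutative A] in
/-- The identity pair is compatible. [cite: NeukirchSchmidtWingberg2008, I §5] -/
theorem compat_refl (g : G) : (ContinuousMulEquiv.refl G') (φ g) = φ ((ContinuousMulEquiv.refl G) g) := rfl

omit [IsTopologicalGroup G'] [A.Normal] [IsMulCommutative A] in
/-- Composites of compatible pairs are compatible. [cite: NeukirchSchmidtWingberg2008, I §5] -/
theorem compat_trans {α₁ α₂ : G ≃ₜ* G} {β₁ β₂ : G' ≃ₜ* G'} (h₁ : ∀ g, β₁ (φ g) = φ (α₁ g))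
    (h₂ : ∀ g, β₂ (φ g) = φ (α₂ g)) (g : G) : (β₁.trans β₂) (φ g) = φ ((α₁.trans α₂) g) := by
  rw [ContinuousMulEquiv.trans_apply, ContinuousMulEquiv.trans_apply, h₁, h₂]

omit [IsTopologicalGroup G'] [A.Normal] [IsMulCommutative A] in
/-- The identity preserves `A`. [cite: NeukirchSchmidtWingberg2008, I §5] -/
theorem mem_refl (a : G') (ha : a ∈ A) : (ContinuousMulEquiv.refl G') a ∈ A := ha

omit [IsTopologicalGroup G'] [A.Normal] [IsMulCommutative A] in
/-- Composites of `A`-preserving automorphisms preserve `A`. [cite: NeukirchSchmidtWingberg2008, I §5] -/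
theorem mem_trans {β₁ β₂ : G' ≃ₜ* G'} (h₁ : ∀ a : G', a ∈ A → β₁ a ∈ A) (h₂ : ∀ a : G', a ∈ A → β₂ a ∈ A)
    (a : G') (ha : a ∈ A) : (β₁.trans β₂) a ∈ A :=
  h₂ _ (h₁ a ha)

/-- **Composition law on `H¹` with a restriction on the composite side**: transporting along `(α₁, β₁)`
(`H₁ → H₂`) and then along `(α₂, β₂)` into `H₃' ≤ H₃` is the restriction to `H₃'` of the transport along the
composite pair into `H₃` (the form used at the direct limit, where the two index subgroups `α₂(α₁ K)` and
`(α₁ ≫ α₂)(K)` agree only propositionally). [cite: NeukirchSchmidtWingberg2008, I §5] -/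
theorem res_autMap_trans {α₁ α₂ : G ≃ₜ* G} {β₁ β₂ : G' ≃ₜ* G'} (h₁ : ∀ g, β₁ (φ g) = φ (α₁ g))
    (h₂ : ∀ g, β₂ (φ g) = φ (α₂ g)) (hA₁ : ∀ a : G', a ∈ A → β₁ a ∈ A) (hA₂ : ∀ a : G', a ∈ A → β₂ a ∈ A)
    {H₁ H₂ H₃ H₃' : Subgroup G} (hH₁ : ∀ x, x ∈ H₂ → α₁.symm x ∈ H₁) (hH₂ : ∀ x, x ∈ H₃' → α₂.symm x ∈ H₂)
    (hH₁₂ : ∀ x, x ∈ H₃ → (α₁.trans α₂).symm x ∈ H₁) (hle : H₃' ≤ H₃) (x : ContH1 φ A H₁) :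
    autMap φ A α₂ β₂ h₂ hA₂ hH₂ (autMap φ A α₁ β₁ h₁ hA₁ hH₁ x) =
      ContH1.res φ A hle
        (autMap φ A (α₁.trans α₂) (β₁.trans β₂) (compat_trans φ h₁ h₂) (mem_trans A hA₁ hA₂) hH₁₂ x) := by
  induction x using QuotientGroup.induction_on with
  | H f => rfl

end ContH1Aut

section Limit

variable {P : TopGroup.{u}} {G' : Type u} [Group G'] [TopologicalSpace G'] [IsTopologicalGroup G']
  (φ : P →* G') (A : Subgroup G') [A.Normal] [IsMulCommutative A] (H : Subgroup P)

omit [IsTopologicalGroup G'] [A.Normal] [IsMulCommutative A] in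
/-- The identity stabilises `H`. [cite: Mochizuki2012, Prop 1.4 p.27] -/
theorem stab_refl (x : P) : x ∈ H ↔ (ContinuousMulEquiv.refl P) x ∈ H := Iff.rfl

omit [IsTopologicalGroup G'] [A.Normal] [IsMulCommutative A] in
/-- Composites of `H`-stabilising automorphisms stabilise `H`. [cite: Mochizuki2012, Prop 1.4 p.27] -/
theorem stab_trans {α₁ α₂ : P ≃ₜ* P} (h₁ : ∀ x, x ∈ H ↔ α₁ x ∈ H) (h₂ : ∀ x, x ∈ H ↔ α₂ x ∈ H) (x : P) :
    x ∈ H ↔ (α₁.trans α₂) x ∈ H := by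
  rw [ContinuousMulEquiv.trans_apply, ← h₂, ← h₁]

/-- `id(K) = K`. [cite: Mochizuki2012, Prop 1.4 p.27] -/
theorem Idx.K_mapAut_refl (i : Idx (P := P) ⊥) : (Idx.mapAut (ContinuousMulEquiv.refl P) i).K = i.K := by
  have h : (ContinuousMulEquiv.refl P).toMulEquiv.toMonoidHom = MonoidHom.id P := MonoidHom.ext fun _ => rfl
  rw [Idx.K_mapAut, h, Subgroup.map_id]

/-- `α₂(α₁ K) = (α₁ ≫ α₂)(K)`. [cite: Mochizuki2012, Prop 1.4 p.27] -/
theorem Idx.K_mapAut_trans (α₁ α₂ : P ≃ₜ* P) (i : Idx (P := P) ⊥) :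
    (Idx.mapAut α₂ (Idx.mapAut α₁ i)).K = (Idx.mapAut (α₁.trans α₂) i).K := by
  rw [Idx.K_mapAut, Idx.K_mapAut, Idx.K_mapAut, Subgroup.map_map]
  rfl

/-- **IDENTITY LAW on the limit**: the identity pair acts as the identity on `lim_K H¹(H|_K, A)`.
[cite: Mochizuki2012, Cor 1.12 (i) p.57] -/
theorem h1LimAut_refl (z : h1Lim φ A H ⊥) :
    h1LimAut φ A H (ContinuousMulEquiv.refl P) (ContinuousMulEquiv.refl G') (ContH1Aut.compat_refl φ)
      (ContH1Aut.mem_refl A) (stab_refl H) z = z := by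
  have key : h1LimAut φ A H (ContinuousMulEquiv.refl P) (ContinuousMulEquiv.refl G') (ContH1Aut.compat_refl φ)
        (ContH1Aut.mem_refl A) (stab_refl H) = AddMonoidHom.id _ := by
    refine h1Lim_hom_ext φ A H fun i y => ?_
    rw [h1LimAut_of, AddMonoidHom.id_apply]
    have hle : i ≤ Idx.mapAut (ContinuousMulEquiv.refl P) i := by
      change (Idx.mapAut (ContinuousMulEquiv.refl P) i).K ≤ i.K
      rw [Idx.K_mapAut_refl]
    rw [← h1Of_fmod φ A H ⊥ hle y]
    exact congrArg (h1Of φ A H ⊥ (Idx.mapAut (ContinuousMulEquiv.refl P) i))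
      (congrArg Additive.ofMul (ContH1Aut.autMap_refl φ A (ContH1Aut.compat_refl φ) (ContH1Aut.mem_refl A)
        (inf_le_inf_left H (Idx.le_iff.mp hle))
        (symm_mem_inf H (ContinuousMulEquiv.refl P) (stab_refl H) i.K) (Additive.toMul y)))
  exact DFunLike.congr_fun key z

/-- **COMPOSITION LAW on the limit**: acting by `(α₁, β₁)` and then by `(α₂, β₂)` is acting by the composite pair
`(α₁ ≫ α₂, β₁ ≫ β₂)`. [cite: Mochizuki2012, Cor 1.12 (i) p.57] -/
theorem h1LimAut_trans {α₁ α₂ : P ≃ₜ* P} {β₁ β₂ : G' ≃ₜ* G'} (h₁ : ∀ g, β₁ (φ g) = φ (α₁ g))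
    (h₂ : ∀ g, β₂ (φ g) = φ (α₂ g)) (hA₁ : ∀ a : G', a ∈ A → β₁ a ∈ A) (hA₂ : ∀ a : G', a ∈ A → β₂ a ∈ A)
    (hH₁ : ∀ x, x ∈ H ↔ α₁ x ∈ H) (hH₂ : ∀ x, x ∈ H ↔ α₂ x ∈ H) (z : h1Lim φ A H ⊥) :
    h1LimAut φ A H α₂ β₂ h₂ hA₂ hH₂ (h1LimAut φ A H α₁ β₁ h₁ hA₁ hH₁ z) =
      h1LimAut φ A H (α₁.trans α₂) (β₁.trans β₂) (ContH1Aut.compat_trans φ h₁ h₂) (ContH1Aut.mem_trans A hA₁ hA₂)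
        (stab_trans H hH₁ hH₂) z := by
  have key : (h1LimAut φ A H α₂ β₂ h₂ hA₂ hH₂).comp (h1LimAut φ A H α₁ β₁ h₁ hA₁ hH₁) =
      h1LimAut φ A H (α₁.trans α₂) (β₁.trans β₂) (ContH1Aut.compat_trans φ h₁ h₂)
        (ContH1Aut.mem_trans A hA₁ hA₂) (stab_trans H hH₁ hH₂) := by
    refine h1Lim_hom_ext φ A H fun i y => ?_
    rw [AddMonoidHom.comp_apply, h1LimAut_of, h1LimAut_of, h1LimAut_of]
    -- indices: `α₂(α₁ K) = (α₁ ≫ α₂)(K)`; compare through `of_f` along the equality (as an inequality)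
    have hle : Idx.mapAut (α₁.trans α₂) i ≤ Idx.mapAut α₂ (Idx.mapAut α₁ i) := by
      change (Idx.mapAut α₂ (Idx.mapAut α₁ i)).K ≤ (Idx.mapAut (α₁.trans α₂) i).K
      rw [Idx.K_mapAut_trans]
    have hH₁₂ : ∀ x, x ∈ H ⊓ (Idx.mapAut (α₁.trans α₂) i).K → (α₁.trans α₂).symm x ∈ H ⊓ i.K :=
      symm_mem_inf H (α₁.trans α₂) (stab_trans H hH₁ hH₂) i.K
    refine Eq.trans ?_ (h1Of_fmod φ A H ⊥ hle _)
    -- `fmod` is restriction: compose the two transports and read the composite at the larger index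
    exact congrArg (h1Of φ A H ⊥ (Idx.mapAut α₂ (Idx.mapAut α₁ i)))
      (congrArg Additive.ofMul (ContH1Aut.res_autMap_trans φ A h₁ h₂ hA₁ hA₂ (symm_mem_inf H α₁ hH₁ i.K)
        (symm_mem_inf H α₂ hH₂ (Idx.mapAut α₁ i).K) hH₁₂ (inf_le_inf_left H (Idx.le_iff.mp hle))
        (Additive.toMul y)))
  exact DFunLike.congr_fun key z

/-- **Identity law for the automorphism** `h1LimAutEquiv` (abc-iut-L6-t1's `CohomologyAutEquiv`).
[cite: Mochizuki2012, Cor 1.12 (i) p.57] -/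
theorem h1LimAutEquiv_refl_apply (z : h1Lim φ A H ⊥) :
    h1LimAutEquiv φ A H (ContinuousMulEquiv.refl P) (ContinuousMulEquiv.refl G') (ContH1Aut.compat_refl φ)
      (fun _ => Iff.rfl) (stab_refl H) z = z :=
  h1LimAut_refl φ A H z

/-- **Composition law for the automorphisms** `h1LimAutEquiv` of two compatible pairs with `βᵢ(A) = A`.
[cite: Mochizuki2012, Cor 1.12 (i) p.57] -/
theorem h1LimAutEquiv_trans_apply {α₁ α₂ : P ≃ₜ* P} {β₁ β₂ : G' ≃ₜ* G'} (h₁ : ∀ g, β₁ (φ g) = φ (α₁ g))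
    (h₂ : ∀ g, β₂ (φ g) = φ (α₂ g)) (hA₁ : ∀ a : G', a ∈ A ↔ β₁ a ∈ A) (hA₂ : ∀ a : G', a ∈ A ↔ β₂ a ∈ A)
    (hH₁ : ∀ x, x ∈ H ↔ α₁ x ∈ H) (hH₂ : ∀ x, x ∈ H ↔ α₂ x ∈ H) (z : h1Lim φ A H ⊥) :
    h1LimAutEquiv φ A H α₂ β₂ h₂ hA₂ hH₂ (h1LimAutEquiv φ A H α₁ β₁ h₁ hA₁ hH₁ z) =
      h1LimAutEquiv φ A H (α₁.trans α₂) (β₁.trans β₂) (ContH1Aut.compat_trans φ h₁ h₂)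
        (fun a => by rw [ContinuousMulEquiv.trans_apply, ← hA₂, ← hA₁]) (stab_trans H hH₁ hH₂) z := by
  rw [h1LimAutEquiv_apply, h1LimAutEquiv_apply, h1LimAutEquiv_apply]
  exact h1LimAut_trans φ A H h₁ h₂ _ _ hH₁ hH₂ z

/-- The automorphisms `h1LimAutEquiv` only depend on the pair `(α, β)`, not on the chosen proofs of compatibility
(rewriting helper for equal pairs). [cite: Mochizuki2012, Cor 1.12 (i) p.57] -/
theorem h1LimAutEquiv_congr {α α' : P ≃ₜ* P} {β β' : G' ≃ₜ* G'} (hα : α = α') (hβ : β = β')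
    (h : ∀ g, β (φ g) = φ (α g)) (hA : ∀ a : G', a ∈ A ↔ β a ∈ A) (hH : ∀ x, x ∈ H ↔ α x ∈ H)
    (h' : ∀ g, β' (φ g) = φ (α' g)) (hA' : ∀ a : G', a ∈ A ↔ β' a ∈ A) (hH' : ∀ x, x ∈ H ↔ α' x ∈ H)
    (z : h1Lim φ A H ⊥) :
    h1LimAutEquiv φ A H α β h hA hH z = h1LimAutEquiv φ A H α' β' h' hA' hH' z := by
  subst hα hβ
  rfl

end Limit

end

end Literature.IUT.HodgeArakelov
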